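import Literature.AlgebraicGeometry.Frobenioids.PadicFrobenioidRmk122
import HarnessLib

/-!
# Frobenioids II, Remark 1.2.2, reading (R2): the characteristic splittings `τ_c` of a `p`-adic Frobenioid

Mochizuki, *The geometry of Frobenioids II*, Kyushu J. Math. **62** (2008) 401–460, §1, Theorem 1.2 (v) p. 9
("the element `p ∈ ℚ_p^×` determines a characteristic splitting") and Remark 1.2.2 p. 10 (the twisted
splittings `u_D · τ`) [cite: MochizukiFrdII2008, Rmk 1.2.2 p.10].

PROOF of the repaired reading (R2) of Remark 1.2.2, sentence 3 (`Datum.Rmk122R2`, `PadicFrobenioidRmk122.lean`;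
FINDING T4g2-F1, registered by abc-iut-L1-lead 2026-08-25 as erratum-candidate): for an absolutely primitive
datum, the construction of Theorem 1.2 (v) works for ANY compatible family of elements `c_{A_D} ∈ K_{A_D}^×`
of valuation `v(p)` in place of `p` —

* `Datum.IsSplittingFamily d c` — `σ_f(c_{A'}) = c_A` along every arrow, `v(c_A) < 1`, and `Div₀(c_A)`
  GENERATES the image of `Φ(A)` in `Φ₀^gp(A)`; examples (absolutely primitive `Φ`): `c = p`
  (`isSplittingFamily_primeUnit`; nonnegativity of the exponent by sharpness of `Φ₀(A)`) and
  `c = u_{A_D}|_{K^×} · p` for a section `u_D` of `O^×(−)` (`isSplittingFamily_up`);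
* `Datum.cSplittingSubmonoid d c X` — `τ_c(A) ⊆ O^▷(A)`: base-identity linear endomorphisms whose rational
  function restricted to `K_{A_D}^×` is a power of `c_{A_D}`; `Datum.cSplitting` — for a splitting family this
  is a `PreFrobenioid.CharacteristicSplitting` (all [FrdI] Def. 2.3 fields proved as for `τ_p`, the case
  `c = p`; also covers splittings "determined by" other generators, e.g. roots of `q_v`, [IUTchI] Ex. 3.2 (iv));
* `Datum.rmk122R2_holds : d.Rmk122R2` — **(R2) PROVED**: `τ_{u·p}` is a characteristic splitting for every
  section `u_D`.

No statement of the paper is strengthened; (R2) is our repaired reading, not the printed sentence.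
-/

noncomputable section

namespace Literature.AlgebraicGeometry.Frobenioids

namespace PadicFrd

open CategoryTheory Opposite Function ValuativeRel

universe v u

namespace Datum

variable {D : Type u} [Category.{v} D] {p : ℕ} [Fact p.Prime] (d : Datum D p)

/-! ### Splitting families -/

/-- A family `c_{A_D} ∈ K_{A_D}^×` "determining a characteristic splitting": compatible with the restriction
maps (`σ_f(c_{A'}) = c_A`), of valuation `< 1`, and such that `Div₀(c_{A_D})` generates the image of
`Φ(A_D)` in `Φ₀^gp(A_D)` — the data replacing "the image of `p ∈ ℚ_p^×` in `K^×`" in reading (R2).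
[cite: MochizukiFrdII2008, Rmk 1.2.2 p.10] -/
structure IsSplittingFamily (c : ∀ A : D, (d.fld A)ˣ) : Prop where
  /-- compatibility with the field homomorphisms under the arrows of `D` -/
  map_eq : ∀ {A A' : D} (f : A ⟶ A'), Units.map ((d.base.map f).alg : d.fld A' →* d.fld A) (c A') = c A
  /-- `v(c_A) < 1` -/
  valuation_lt_one : ∀ A : D, valuation (d.fld A) (c A : d.fld A) < 1
  /-- every `ι(z)`, `z ∈ Φ(A)`, is a (nonnegative) power of `Div₀(c_A)` -/
  generates : ∀ (A : D) (z : d.Φ.obj (op A)),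
    ∃ k : ℕ, MonGp.map (d.ιHom A) (Algebra.GrothendieckGroup.of z) = divZeroHom (d.fld A) (c A) ^ k

/-- For absolutely primitive `Φ`, every `ι(z)`, `z ∈ Φ(A)`, is a NONNEGATIVE power of `Div₀(p) = ord(p) ⊗ 1`
(absolute primitivity gives an integer exponent; negative exponents are excluded since
`Φ₀(A) = ord(O_K^⊳) ⊗ ℝ_{≥0}` is sharp — abc-iut-L1-d10's `isMonoprime_ordInt` realified — and `ord(p) ≠ 0`).
[cite: MochizukiFrdII2008, Thm 1.2 (v) p.10] -/
theorem exists_map_ιHom_of_eq_divZeroHom_primeUnit_pow (hap : d.IsAbsolutelyPrimitive) (A : D)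
    (z : d.Φ.obj (op A)) :
    ∃ m : ℕ, MonGp.map (d.ιHom A) (Algebra.GrothendieckGroup.of z) = divZeroHom (d.fld A) (d.primeUnit A) ^ m := by
  obtain ⟨⟨inst, hfin, hc⟩⟩ := d.isPadicLocal A
  letI := inst
  haveI := hfin
  haveI := isCancelMul_realification (OrdInt (d.fld A))
  have hmem : MonGp.map (d.ιHom A) (Algebra.GrothendieckGroup.of z) ∈
      Subgroup.zpowers (d.ordIntGp A (Associates.mk ⟨((p : ℕ) : d.fld A), (d.base.obj A).p_mem⟩)) :=
    d.mem_zpowers_of_isAbsolutelyPrimitive hap A _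
  obtain ⟨k, hk⟩ := Subgroup.mem_zpowers_iff.mp hmem
  rw [MonGp.map_of] at hk
  set rp : Realification (OrdInt (d.fld A)) := Realification.of (OrdInt (d.fld A))
    (Associates.mk ⟨((p : ℕ) : d.fld A), (d.base.obj A).p_mem⟩) with hrp
  have hgen : d.ordIntGp A (Associates.mk ⟨((p : ℕ) : d.fld A), (d.base.obj A).p_mem⟩) =
      Algebra.GrothendieckGroup.of rp := rfl
  have hk0 : 0 ≤ k := by
    by_contra hneg
    rw [not_le] at hneg
    obtain ⟨m, hm⟩ := Int.exists_eq_neg_ofNat hneg.le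
    have hm0 : m ≠ 0 := by
      rintro rfl
      simp only [Nat.cast_zero, neg_zero] at hm
      omega
    rw [hm, hgen, zpow_neg, zpow_natCast, ← map_pow, inv_eq_iff_mul_eq_one, mul_comm, ← map_mul] at hk
    have h1 : d.ιHom A z * rp ^ m = 1 := Algebra.GrothendieckGroup.of_injective (hk.trans (map_one _).symm)
    have hmono : IsMonoprime (OrdInt (d.fld A)) := isMonoprime_ordInt hc
    have hsharp : IsSharp (Realification (OrdInt (d.fld A))) :=
      (IsMonoprime.ofR (isRMonoprime_realification hmono)).isSharp
    have hrp1 : rp = 1 := hsharp.1 rp ((isUnit_pow_iff hm0).mp (IsUnit.of_mul_eq_one_right _ h1))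
    have h2 : Associates.mk (⟨((p : ℕ) : d.fld A), (d.base.obj A).p_mem⟩ : intNonzero (d.fld A)) = 1 :=
      Realification.of_injective hmono (hrp1.trans (map_one _).symm)
    rw [Associates.mk_eq_one] at h2
    exact (d.base.obj A).p_lt.ne ((isUnit_intNonzero_iff (d.fld A) _).mp h2)
  obtain ⟨m, rfl⟩ := Int.eq_ofNat_of_zero_le hk0
  refine ⟨m, ?_⟩
  rw [MonGp.map_of, ← hk, zpow_natCast, d.divZeroHom_primeUnit]

/-- For absolutely primitive `Φ`, `c = p` is a splitting family (Thm. 1.2 (v)). [cite: MochizukiFrdII2008, Thm 1.2 (v) p.10] -/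
theorem isSplittingFamily_primeUnit (hap : d.IsAbsolutelyPrimitive) : d.IsSplittingFamily d.primeUnit :=
  ⟨fun f => d.units_map_primeUnit f, fun A => (d.base.obj A).p_lt,
    fun A z => d.exists_map_ιHom_of_eq_divZeroHom_primeUnit_pow hap A z⟩

/-- For absolutely primitive `Φ`, `c = u_D|_{K^×} · p` is a splitting family for every section `u_D` of
`O^×(−)` (`Div₀(u · p) = Div₀(p)` as `u|_{K^×} ∈ O_K^× = Ker(Div₀)`). [cite: MochizukiFrdII2008, Rmk 1.2.2 p.10] -/
theorem isSplittingFamily_up (hap : d.IsAbsolutelyPrimitive) (s : d.UnitSection) :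
    d.IsSplittingFamily fun A => d.resK A (s.u A) * d.primeUnit A := by
  refine ⟨fun f => ?_, fun A => ?_, fun A z => ?_⟩
  · rw [map_mul, s.units_map_resK_u, d.units_map_primeUnit]
  · have hu := s.resK_u_mem_unitSubgroup A
    rw [mem_unitSubgroup_iff] at hu
    rw [Units.val_mul, map_mul, hu, one_mul, coe_primeUnit]
    exact (d.base.obj A).p_lt
  · obtain ⟨⟨inst, hfin, hcomp⟩⟩ := d.isPadicLocal A
    letI := inst
    haveI := hfin
    have hu : divZeroHom (d.fld A) (d.resK A (s.u A)) = 1 := by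
      rw [← MonoidHom.mem_ker, ker_divZeroHom_eq_unitSubgroup hcomp]
      exact s.resK_u_mem_unitSubgroup A
    obtain ⟨m, hm⟩ := d.exists_map_ιHom_of_eq_divZeroHom_primeUnit_pow hap A z
    exact ⟨m, by rw [hm, map_mul, hu, one_mul]⟩

variable {d} in
/-- Powers of `v(c)` are injective in the exponent (`0 < v(c) < 1`). [cite: MochizukiFrdII2008, Ex 1.1 (i) p.7] -/
theorem IsSplittingFamily.valuation_pow_injective {c : ∀ A : D, (d.fld A)ˣ} (hc : d.IsSplittingFamily c)
    (A : D) : Injective fun m : ℕ => valuation (d.fld A) ((c A : d.fld A) ^ m) := by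
  intro m n h
  simp only [map_pow] at h
  have h0 : valuation (d.fld A) (c A : d.fld A) ≠ 0 := (Valuation.ne_zero_iff _).mpr (c A).ne_zero
  exact (pow_right_strictAnti₀ (zero_lt_iff.mpr h0) (hc.valuation_lt_one A)).injective h

/-! ### The splittings `τ_c` -/

/-- `τ_c(A) ⊆ O^▷(A)`: the base-identity linear endomorphisms of `A = (A_D, α)` whose rational function
restricted to `K_{A_D}^×` is a power of `c_{A_D}` (`c = p`: the splitting of Thm. 1.2 (v); `c = u · p`: the
twisted splitting of reading (R2) of Rmk. 1.2.2). [cite: MochizukiFrdII2008, Rmk 1.2.2 p.10] -/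
def cSplittingSubmonoid (c : ∀ A : D, (d.fld A)ˣ) (X : d.frobenioid) : Submonoid (End X) where
  carrier := {e | e ∈ PreFrobenioid.endSubmonoid d.structureFunctor X ∧
    ∃ m : ℕ, d.resK X.base (ModelFrobenioid.unit (End.asHom e)) = c X.base ^ m}
  one_mem' := ⟨Submonoid.one_mem _, 0, by
    rw [pow_zero]
    change d.resK X.base (ModelFrobenioid.unit (𝟙 X)) = 1
    rw [ModelFrobenioid.unit_id, map_one]⟩
  mul_mem' := by
    rintro a b ⟨ha, m, hm⟩ ⟨hb, m', hm'⟩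
    refine ⟨Submonoid.mul_mem _ ha hb, m + m', ?_⟩
    change d.resK X.base (ModelFrobenioid.unit (End.asHom b ≫ End.asHom a)) = _
    rw [d.unit_comp_of_mem (e := End.asHom a) (e' := End.asHom b) ha hb, map_mul, hm, hm', pow_add]

/-- `τ_p = τ_c` for `c = p`. [cite: MochizukiFrdII2008, Thm 1.2 (v) p.10] -/
theorem pSplittingSubmonoid_eq_cSplittingSubmonoid : d.pSplittingSubmonoid = d.cSplittingSubmonoid d.primeUnit :=
  funext fun _ => Submonoid.ext fun _ => Iff.rfl

/-- `τ_{u·p} = τ_c` for `c = u|_{K^×} · p`. [cite: MochizukiFrdII2008, Rmk 1.2.2 p.10] -/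
theorem upSplittingSubmonoid_eq_cSplittingSubmonoid (s : d.UnitSection) :
    s.upSplittingSubmonoid = d.cSplittingSubmonoid fun A => d.resK A (s.u A) * d.primeUnit A :=
  funext fun _ => Submonoid.ext fun _ => Iff.rfl

/-- `τ_c(A) ⊆ O^▷(A)`. [cite: MochizukiFrdII2008, Rmk 1.2.2 p.10] -/
theorem cSplittingSubmonoid_le (c : ∀ A : D, (d.fld A)ˣ) (X : d.frobenioid) :
    d.cSplittingSubmonoid c X ≤ PreFrobenioid.endSubmonoid d.structureFunctor X := fun _ he => he.1

/-- Subfunctoriality of `τ_c` on linear morphisms: the pull-back `α` of `β ∈ τ_c(B)` along a linear `φ` has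
`u_α = B(Base φ)(u_β)`, whose restriction to `K^×` is `σ(c^m) = c^m`. [cite: MochizukiFrdII2008, Rmk 1.2.2 p.10] -/
theorem mem_cSplittingSubmonoid_of_comp_eq {c : ∀ A : D, (d.fld A)ˣ} (hc : d.IsSplittingFamily c)
    {X Y : d.frobenioid} (φ : X ⟶ Y) (hφ : PreFrobenioid.IsLinear d.structureFunctor φ) {β : End Y}
    (hβ : β ∈ d.cSplittingSubmonoid c Y) {α : End X} (hα : α ∈ PreFrobenioid.endSubmonoid d.structureFunctor X)
    (h : φ ≫ End.asHom β = End.asHom α ≫ φ) : α ∈ d.cSplittingSubmonoid c X := by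
  obtain ⟨hβe, m, hm⟩ := hβ
  refine ⟨hα, m, ?_⟩
  have hu := congrArg ModelFrobenioid.unit h
  have hdφ : ModelFrobenioid.degFr φ = 1 := hφ
  have hdβ : ModelFrobenioid.degFr (End.asHom β) = 1 := hβe.2
  have hbα : ModelFrobenioid.baseMap (End.asHom α) = 𝟙 X.base := hα.1
  rw [ModelFrobenioid.unit_comp, ModelFrobenioid.unit_comp, hdφ, hdβ, hbα, PNat.one_coe, pow_one,
    pow_one, ModelFrobenioid.map_id_apply_B,
    mul_comm (ModelFrobenioid.unit φ) (ModelFrobenioid.unit (End.asHom α))] at hu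
  obtain ⟨cu, hcu⟩ := d.isUnit_B (op X.base) (ModelFrobenioid.unit φ)
  rw [← hcu] at hu
  have hu' : (d.B.map (ModelFrobenioid.baseMap φ).op).hom (ModelFrobenioid.unit (End.asHom β)) =
      ModelFrobenioid.unit (End.asHom α) := (Units.mul_left_inj cu).mp hu
  rw [← hu', d.resK_mapB, hm, map_pow, hc.map_eq]

/-- [FrdI] Def. 2.3 (b) for every linear morphism: for `β ∈ O^▷(B)` and a linear `φ : A → B` the
endomorphism `α := (1, id, Φ(Base φ)(Div β), B(Base φ)(u_β))` of `A` satisfies `β ∘ φ = φ ∘ α` (as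
`Datum.exists_comp_eq_of_isLinear`, for an arbitrary base-identity linear `β`).
[cite: MochizukiFrdII2008, Thm 1.2 (v) p.10] -/
theorem exists_comp_eq_of_isLinear' {X Y : d.frobenioid} (φ : X ⟶ Y)
    (hφ : PreFrobenioid.IsLinear d.structureFunctor φ) {β : End Y}
    (hβ : β ∈ PreFrobenioid.endSubmonoid d.structureFunctor Y) :
    ∃ α ∈ PreFrobenioid.endSubmonoid d.structureFunctor X, φ ≫ End.asHom β = End.asHom α ≫ φ := by
  have hβr := d.of_div_eq_divB_unit (e := End.asHom β) hβ
  have hdφ : ModelFrobenioid.degFr φ = 1 := hφ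
  have hdβ : ModelFrobenioid.degFr (End.asHom β) = 1 := hβ.2
  have hbβ : ModelFrobenioid.baseMap (End.asHom β) = 𝟙 Y.base := hβ.1
  refine ⟨End.of (ModelFrobenioid.unitEnd X
    ((d.Φ.map (ModelFrobenioid.baseMap φ).op).hom (ModelFrobenioid.div (End.asHom β)))
    ((d.B.map (ModelFrobenioid.baseMap φ).op).hom (ModelFrobenioid.unit (End.asHom β)))
    (ModelFrobenioid.of_map_eq_divB_map _ hβr)), d.unitEnd_mem_endSubmonoid X _ _ _,
    ModelFrobenioid.hom_ext ?_ ?_ ?_ ?_⟩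
  · rw [ModelFrobenioid.degFr_comp, ModelFrobenioid.degFr_comp, hdβ, one_mul]
    exact (mul_one _).symm
  · rw [ModelFrobenioid.baseMap_comp, ModelFrobenioid.baseMap_comp, hbβ, Category.comp_id]
    exact (Category.id_comp _).symm
  · rw [ModelFrobenioid.div_comp, ModelFrobenioid.div_comp, hdβ, hdφ, PNat.one_coe, pow_one, pow_one]
    change _ = (d.Φ.map (𝟙 X.base).op).hom (ModelFrobenioid.div φ) *
      (d.Φ.map (ModelFrobenioid.baseMap φ).op).hom (ModelFrobenioid.div (End.asHom β))
    rw [ModelFrobenioid.map_id_apply_Φ, mul_comm]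
  · rw [ModelFrobenioid.unit_comp, ModelFrobenioid.unit_comp, hdβ, hdφ, PNat.one_coe, pow_one, pow_one]
    change _ = (d.B.map (𝟙 X.base).op).hom (ModelFrobenioid.unit φ) *
      (d.B.map (ModelFrobenioid.baseMap φ).op).hom (ModelFrobenioid.unit (End.asHom β))
    rw [ModelFrobenioid.map_id_apply_B, mul_comm]

/-- A base-identity linear endomorphism whose rational function restricts to `1 ∈ K^×` is the identity
(`Div_B(u) = 0` by the cartesian square and injectivity of `ι^gp`, then `u = 1`).
[cite: MochizukiFrdII2008, Thm 1.2 (v) p.10] -/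
theorem eq_id_of_resK_unit_eq_one {X : d.frobenioid} {w : X ⟶ X}
    (hw : w ∈ PreFrobenioid.endSubmonoid d.structureFunctor X)
    (h1 : d.resK X.base (ModelFrobenioid.unit w) = 1) : w = 𝟙 X := by
  have hunit : ModelFrobenioid.unit w = 1 := by
    refine d.resK_ext X.base ?_ ?_
    · rw [map_one]
      exact h1
    · haveI := isCancelMul_realification (OrdInt (d.fld X.base))
      have hι : Injective (MonGp.map (d.ιHom X.base)) := MonGp.map_injective _ (d.ιHom_injective X.base)
      apply hι
      rw [← d.divZeroHom_resK, h1, map_one, map_one, map_one]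
  exact d.eq_of_mem_of_unit_eq (e' := 𝟙 X) hw ⟨rfl, rfl⟩ (by rw [hunit, ModelFrobenioid.unit_id])

/-- `τ_c(A) → O^▷(A)^char` is injective. [cite: MochizukiFrdII2008, Rmk 1.2.2 p.10] -/
theorem eq_of_associated_of_mem_cSplittingSubmonoid {c : ∀ A : D, (d.fld A)ˣ} (hc : d.IsSplittingFamily c)
    {X : d.frobenioid} {t t' : End X} (ht : t ∈ d.cSplittingSubmonoid c X) (ht' : t' ∈ d.cSplittingSubmonoid c X)
    (h : Associated (⟨t, ht.1⟩ : PreFrobenioid.endSubmonoid d.structureFunctor X) ⟨t', ht'.1⟩) :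
    t = t' := by
  obtain ⟨w, hw⟩ := h
  obtain ⟨m, hm⟩ := ht.2
  obtain ⟨m', hm'⟩ := ht'.2
  have hwK := d.resK_unit_mem_unitSubgroup_of_isUnit w.isUnit
  rw [mem_unitSubgroup_iff] at hwK
  have hw2 : End.asHom ((w : PreFrobenioid.endSubmonoid d.structureFunctor X) : End X) ≫ End.asHom t =
      End.asHom t' := by
    have hw1 := congrArg (fun s : PreFrobenioid.endSubmonoid d.structureFunctor X => End.asHom (s : End X)) hw
    simp only [Submonoid.coe_mul] at hw1
    exact hw1
  have hprod : d.resK X.base (ModelFrobenioid.unit (End.asHom t')) =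
      d.resK X.base (ModelFrobenioid.unit (End.asHom t)) *
        d.resK X.base (ModelFrobenioid.unit (End.asHom ((w : PreFrobenioid.endSubmonoid d.structureFunctor X) : End X))) := by
    rw [← hw2, d.unit_comp_of_mem (e := End.asHom t)
      (e' := End.asHom ((w : PreFrobenioid.endSubmonoid d.structureFunctor X) : End X)) ht.1
      (w : PreFrobenioid.endSubmonoid d.structureFunctor X).2, map_mul]
  rw [hm, hm'] at hprod
  have hval := congrArg (fun x : (d.fld X.base)ˣ => valuation (d.fld X.base) (x : d.fld X.base)) hprod
  simp only [Units.val_mul, map_mul, hwK, mul_one] at hval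
  have hmm : m' = m := hc.valuation_pow_injective X.base (by simpa only [Units.val_pow_eq_pow_val] using hval)
  subst hmm
  have hw1 : d.resK X.base (ModelFrobenioid.unit
      (End.asHom ((w : PreFrobenioid.endSubmonoid d.structureFunctor X) : End X))) = 1 :=
    mul_eq_left.mp hprod.symm
  rw [d.eq_id_of_resK_unit_eq_one (w : PreFrobenioid.endSubmonoid d.structureFunctor X).2 hw1,
    Category.id_comp] at hw2
  exact hw2

/-- Every `e ∈ O^▷(A)` factors as `t · w` with `w ∈ O^×(A)` and `t` of PRESCRIBED rational function `x|_{K^×}`,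
for any `x ∈ K^×` with `Div₀(x) = Div₀(u_e|_{K^×})` (lift the unit `u_e|_{K^×} / x ∈ O_K^×` to a unit `w` of `A`,
abc-iut-L1-d10's `exists_B_over_unit`, and put `t := (1, id, Div e, u_e · u_w⁻¹)`).
[cite: MochizukiFrdII2008, Thm 1.2 (v) p.10] -/
theorem exists_associated_of_divZeroHom_eq {X : d.frobenioid} {e : End X}
    (he : e ∈ PreFrobenioid.endSubmonoid d.structureFunctor X) (x : (d.fld X.base)ˣ)
    (hx : divZeroHom (d.fld X.base) (d.resK X.base (ModelFrobenioid.unit (End.asHom e))) =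
      divZeroHom (d.fld X.base) x) :
    ∃ (t : End X) (ht : t ∈ PreFrobenioid.endSubmonoid d.structureFunctor X),
      d.resK X.base (ModelFrobenioid.unit (End.asHom t)) = x ∧
        Associated (⟨t, ht⟩ : PreFrobenioid.endSubmonoid d.structureFunctor X) ⟨e, he⟩ := by
  obtain ⟨⟨inst, hfin, hcomp⟩⟩ := d.isPadicLocal X.base
  letI := inst
  haveI := hfin
  have heE : End.asHom e ∈ PreFrobenioid.endSubmonoid d.structureFunctor X := he
  set y : (d.fld X.base)ˣ := d.resK X.base (ModelFrobenioid.unit (End.asHom e)) * x⁻¹ with hy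
  have hyU : y ∈ unitSubgroup (d.fld X.base) := by
    rw [← ker_divZeroHom_eq_unitSubgroup hcomp, MonoidHom.mem_ker, hy, map_mul, map_inv, hx, mul_inv_cancel]
  obtain ⟨uw, huw₁, huw₂⟩ := d.exists_B_over_unit (op X.base) y hyU
  obtain ⟨cw, rfl⟩ := d.isUnit_B (op X.base) uw
  have huw₁' : d.resK X.base (cw : d.B.obj (op X.base)) = y := huw₁
  have hw₁ : Algebra.GrothendieckGroup.of (1 : d.Φ.obj (op X.base)) =
      Frobenioids.divB d.Φ d.B d.divB (op X.base) (cw : d.B.obj (op X.base)) := by rw [map_one, huw₂]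
  have hcw' : Frobenioids.divB d.Φ d.B d.divB (op X.base) ((cw⁻¹ : (d.B.obj (op X.base))ˣ) : _) = 1 := by
    have h : Frobenioids.divB d.Φ d.B d.divB (op X.base) ((cw⁻¹ : (d.B.obj (op X.base))ˣ) : _) =
        (Frobenioids.divB d.Φ d.B d.divB (op X.base) (cw : _))⁻¹ :=
      eq_inv_of_mul_eq_one_right (by rw [← map_mul, Units.mul_inv, map_one])
    rw [h, huw₂, inv_one]
  have hw₂ : Algebra.GrothendieckGroup.of (1 : d.Φ.obj (op X.base)) =
      Frobenioids.divB d.Φ d.B d.divB (op X.base) ((cw⁻¹ : (d.B.obj (op X.base))ˣ) : _) := by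
    rw [map_one, hcw']
  have ht₀ : Algebra.GrothendieckGroup.of (ModelFrobenioid.div (End.asHom e)) =
      Frobenioids.divB d.Φ d.B d.divB (op X.base)
        (ModelFrobenioid.unit (End.asHom e) * ((cw⁻¹ : (d.B.obj (op X.base))ˣ) : _)) := by
    rw [map_mul, hcw', mul_one]
    exact d.of_div_eq_divB_unit heE
  let w : X ⟶ X := ModelFrobenioid.unitEnd X 1 (cw : d.B.obj (op X.base)) hw₁
  let w' : X ⟶ X := ModelFrobenioid.unitEnd X 1 ((cw⁻¹ : (d.B.obj (op X.base))ˣ) : _) hw₂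
  let t : X ⟶ X := ModelFrobenioid.unitEnd X (ModelFrobenioid.div (End.asHom e))
    (ModelFrobenioid.unit (End.asHom e) * ((cw⁻¹ : (d.B.obj (op X.base))ˣ) : _)) ht₀
  have hwm : End.of w ∈ PreFrobenioid.endSubmonoid d.structureFunctor X := d.unitEnd_mem_endSubmonoid X _ _ _
  have hw'm : End.of w' ∈ PreFrobenioid.endSubmonoid d.structureFunctor X := d.unitEnd_mem_endSubmonoid X _ _ _
  have htm : End.of t ∈ PreFrobenioid.endSubmonoid d.structureFunctor X := d.unitEnd_mem_endSubmonoid X _ _ _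
  have hinv : d.resK X.base ((cw⁻¹ : (d.B.obj (op X.base))ˣ) : _) = y⁻¹ := by
    rw [← huw₁', ← Units.coe_map, ← Units.coe_map, map_inv, Units.val_inv_eq_inv_val]
  have htK : d.resK X.base (ModelFrobenioid.unit (End.asHom (End.of t))) = x := by
    change d.resK X.base (ModelFrobenioid.unit (End.asHom e) * ((cw⁻¹ : (d.B.obj (op X.base))ˣ) : _)) = _
    rw [map_mul, hinv, hy, mul_inv_rev, inv_inv, mul_comm x, mul_inv_cancel_left]
  have hww' : (⟨End.of w, hwm⟩ : PreFrobenioid.endSubmonoid d.structureFunctor X) * ⟨End.of w', hw'm⟩ = 1 := by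
    apply Subtype.ext
    change w' ≫ w = 𝟙 X
    refine ModelFrobenioid.hom_ext ?_ ?_ ?_ ?_
    · exact mul_one _
    · exact Category.id_comp _
    · change (d.Φ.map (𝟙 X.base).op).hom 1 * 1 ^ ((1 : ℕ+) : ℕ) = 1
      rw [map_one, one_pow, mul_one]
    · change (d.B.map (𝟙 X.base).op).hom (cw : d.B.obj (op X.base)) *
        ((cw⁻¹ : (d.B.obj (op X.base))ˣ) : _) ^ ((1 : ℕ+) : ℕ) = 1
      rw [ModelFrobenioid.map_id_apply_B, PNat.one_coe, pow_one, Units.mul_inv]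
  have hw'w : (⟨End.of w', hw'm⟩ : PreFrobenioid.endSubmonoid d.structureFunctor X) * ⟨End.of w, hwm⟩ = 1 := by
    apply Subtype.ext
    change w ≫ w' = 𝟙 X
    refine ModelFrobenioid.hom_ext ?_ ?_ ?_ ?_
    · exact mul_one _
    · exact Category.id_comp _
    · change (d.Φ.map (𝟙 X.base).op).hom 1 * 1 ^ ((1 : ℕ+) : ℕ) = 1
      rw [map_one, one_pow, mul_one]
    · change (d.B.map (𝟙 X.base).op).hom ((cw⁻¹ : (d.B.obj (op X.base))ˣ) : _) *
        (cw : d.B.obj (op X.base)) ^ ((1 : ℕ+) : ℕ) = 1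
      rw [ModelFrobenioid.map_id_apply_B, PNat.one_coe, pow_one, Units.inv_mul]
  let W : (PreFrobenioid.endSubmonoid d.structureFunctor X)ˣ := ⟨⟨End.of w, hwm⟩, ⟨End.of w', hw'm⟩, hww', hw'w⟩
  refine ⟨End.of t, htm, htK, W, Subtype.ext ?_⟩
  change w ≫ t = End.asHom e
  have h1 : ModelFrobenioid.degFr (End.asHom e) = 1 := he.2
  have h2 : ModelFrobenioid.baseMap (End.asHom e) = 𝟙 X.base := he.1
  refine ModelFrobenioid.hom_ext ?_ ?_ ?_ ?_
  · rw [h1]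
    exact mul_one _
  · rw [h2]
    exact Category.id_comp _
  · change (d.Φ.map (𝟙 X.base).op).hom (ModelFrobenioid.div (End.asHom e)) * 1 ^ ((1 : ℕ+) : ℕ) =
      ModelFrobenioid.div (End.asHom e)
    rw [ModelFrobenioid.map_id_apply_Φ, one_pow, mul_one]
  · change (d.B.map (𝟙 X.base).op).hom
        (ModelFrobenioid.unit (End.asHom e) * ((cw⁻¹ : (d.B.obj (op X.base))ˣ) : _)) *
        (cw : d.B.obj (op X.base)) ^ ((1 : ℕ+) : ℕ) = ModelFrobenioid.unit (End.asHom e)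
    rw [ModelFrobenioid.map_id_apply_B, PNat.one_coe, pow_one, Units.inv_mul_cancel_right]

/-- `τ_c(A) → O^▷(A)^char` is surjective for a splitting family `c`: `Div₀(u_e|_{K^×}) = ι^gp(Div e) = Div₀(c^k)`
with `k ∈ ℕ` (`generates`), then factor `e = t · w` with `u_t|_{K^×} = c^k`. [cite: MochizukiFrdII2008, Rmk 1.2.2 p.10] -/
theorem exists_mem_cSplittingSubmonoid_associated {c : ∀ A : D, (d.fld A)ˣ} (hc : d.IsSplittingFamily c)
    {X : d.frobenioid} {e : End X} (he : e ∈ PreFrobenioid.endSubmonoid d.structureFunctor X) :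
    ∃ (t : End X) (ht : t ∈ d.cSplittingSubmonoid c X),
      Associated (⟨t, ht.1⟩ : PreFrobenioid.endSubmonoid d.structureFunctor X) ⟨e, he⟩ := by
  have heE : End.asHom e ∈ PreFrobenioid.endSubmonoid d.structureFunctor X := he
  have hsq := d.divZeroHom_resK X.base (ModelFrobenioid.unit (End.asHom e))
  obtain ⟨k, hk⟩ := hc.generates X.base (ModelFrobenioid.div (End.asHom e))
  rw [← d.of_div_eq_divB_unit heE, hk, ← map_pow] at hsq
  obtain ⟨t, ht, htx, hte⟩ := d.exists_associated_of_divZeroHom_eq he (c X.base ^ k) hsq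
  exact ⟨t, ⟨ht, k, htx⟩, hte⟩

/-- **The characteristic splitting `τ_c`** determined by a splitting family `c`: `A ↦ τ_c(A)` is a
characteristic splitting on `C` in the sense of [FrdI] Def. 2.3 (abc-iut-L1-t2's
`PreFrobenioid.CharacteristicSplitting`), all conditions PROVED (`c = p` recovers Thm. 1.2 (v)).
[cite: MochizukiFrdII2008, Rmk 1.2.2 p.10] -/
def cSplitting {c : ∀ A : D, (d.fld A)ˣ} (hc : d.IsSplittingFamily c) :
    PreFrobenioid.CharacteristicSplitting d.structureFunctor where
  τ := d.cSplittingSubmonoid c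
  τ_le := fun {X} _ => d.cSplittingSubmonoid_le c X
  res_mem := fun {_ _} _ _ φ hφ _ hβ _ hα h => d.mem_cSplittingSubmonoid_of_comp_eq hc φ hφ hβ hα h
  bijective := fun {X} _ => by
    constructor
    · rintro ⟨t, ht⟩ ⟨t', ht'⟩ h
      exact Subtype.ext (d.eq_of_associated_of_mem_cSplittingSubmonoid hc ht ht'
        (Associates.mk_eq_mk_iff_associated.mp h))
    · intro q
      obtain ⟨e, rfl⟩ := Associates.mk_surjective q
      obtain ⟨t, ht, hte⟩ := d.exists_mem_cSplittingSubmonoid_associated hc e.2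
      exact ⟨⟨t, ht⟩, Associates.mk_eq_mk_iff_associated.mpr hte⟩
  hull := fun {_ _} φ hφ _ hβ => d.exists_comp_eq_of_isLinear' φ hφ.2.1.1 hβ.1

/-- The `τ`-component of `cSplitting`. [cite: MochizukiFrdII2008, Rmk 1.2.2 p.10] -/
@[simp] theorem cSplitting_τ {c : ∀ A : D, (d.fld A)ˣ} (hc : d.IsSplittingFamily c) : (d.cSplitting hc).τ = d.cSplittingSubmonoid c := rfl

/-- **Reading (R2) of Remark 1.2.2, sentence 3 — PROVED** (`Datum.Rmk122R2`): for every absolutely primitive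
datum and every section `u_D` of `O^×(−)`, the twisted splitting `τ_{u·p}` is a characteristic splitting on `C`.
[cite: MochizukiFrdII2008, Rmk 1.2.2 p.10] -/
theorem rmk122R2_holds : d.Rmk122R2 := fun hap s =>
  ⟨d.cSplitting (d.isSplittingFamily_up hap s), by rw [cSplitting_τ, upSplittingSubmonoid_eq_cSplittingSubmonoid]⟩

end Datum

end PadicFrd

end Literature.AlgebraicGeometry.Frobenioids
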